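import Summits.QuantumFields.YangMills.Theorems.BalabanUVNodesN18KingModelTorusMassUniform
import Summits.QuantumFields.YangMills.Theorems.BalabanUVNodesN18KingModelTorusDeriv
import Literature.MathematicalPhysics.QuantumFieldTheory.King1986.MinimizerTwoSpacingDerivUniform

/-!
# BalabanUVNodes ∕ N18 — King's (3.73), SECOND BOUND (the lattice DERIVATIVE `∂_μ` on an external line), `j ≥ 1`, FOR KING'S
# ACTUAL OPERATORS ON BAŁABAN'S TORI — THE MASS-UNIFORM EDITION: `κ, C₅` functions of `(d, L, a, m₀², γ)` ONLY, EVERY domain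
# reading ITS OWN mass in `(0, m₀²]`, in particular King's PHYSICAL slice masses `m²(L^jη)²` of (2.20) (Track A, DAG node N18 =
# NE5 `T4OutputRate.NE5 EA EB W κ θ C₅` :211; cluster K4; row s3 «King-model transfer `N18KingModelTorus` (κ, C₅ from
# (d, L, a, m², γ))»; module 13 of seat pub-ymgap-dag-n18-e (g11), `--supports stmt-QuantumFields-20292 --as helper` = K3⁗
# `SpineGivenEndpointR13Sep`)

HONEST FRAMING.  Count-neutral kernel bookkeeping.  King's A = 0 scalar MODEL of the NE5 mechanism on finite tori (template
literature, published and proved) — NOT Bałaban's covariant one-step outputs `E^{(j)}(X; g, U)`, for which NE5 is NOT IN PRINT and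
has no tree producer; NOT a node discharge; nothing continuum ∕ ℝ⁴ ∕ OS ∕ mass-gap ∕ Clay.  THEOREMS ONLY: 0 `def`, 0 `sorry`,
standard axioms.

THE POINT.  `N18KingModelTorusDeriv.ne5_kingModel_threeFactorDeriv_torus` (p418964) is King's (3.73), SECOND bound («the other
bounds follow in the same way», p. 675) — the (4.42) three-factor graph with the row `a_jG^η_jQ^*_j(x, ·)` replaced by its lattice
derivative `∂^η_μ` — as a multi-scale inhabitant of N18's decl of record with `κ > 0`, `C₅ ≥ 0` «functions of `d, L, a, m², γ`
only»; like the first bound's p418046 it reads ONE lattice-unit mass `m²` at EVERY scale `j`.  By King's rescaling (2.20) p. 654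
the slice of (2.17) at scale `j` carries, in scale-`j` lattice units, the mass `m²(L^jη)²` — a different number at every scale,
all in `(0, m²]` — so p418964 speaks of unphysical masses across scales.  Module 12 (`N18KingModelTorusMassUniform`, p501274)
repaired this for the FIRST bound on the mass-uniform roots of seat n15-e (`B4Thm110ZeroTorusUniform`, `King1986/MinimizerDecayUniform`);
THIS FILE is the same repair for the SECOND bound, on n15-e's mass-uniform twin of n18-b's derivative chain
(`King1986/MinimizerTwoSpacingDerivUniform`: `dminimiser_kernel_decay_blocks_unif`, `king_prop38_deriv_torus_blocks_unif`):
* §1 `dminimiser_row_decay_unif` ∕ `dminimiser_row_rate_unif` — the derivative row's read-out shapes of `MinimizerTwoSpacingDeriv`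
  §5 with `∀ m² ≤ m₀²` INSIDE the `∃ δ₀ c₀` (corollaries of the two `_unif` theorems, `a_K ≤ a`, any common smaller rate).
* §2 **`ne5_kingModel_threeFactorDeriv_torus_unif`** — `κ > 0`, `C₅ ≥ 0` functions of `(d, L, a, m₀², γ)` ONLY, such that
  p418964's conclusion `NE5 EA EB W κ (L^{−γ∕2}) C₅` holds for EVERY MASS PROFILE `0 < mass X ≤ m₀²` read by both runs' derivative
  three-factor graphs at `X` (module 12 §2's mass-profile assembly `ne5_of_threeFactorRates_lemma45_massProfile` takes arbitrary rows;
  the derivative row and its rate are fed in from §1, the column and its rate from module 12 §1).  p418964 = the constant profile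
  `mass X = m²`, cap `m²`.
* §3 **`ne5_kingModel_threeFactorDeriv_torus_physMass`** — §2 at King's PHYSICAL profile `mass X = m²·(L^{scale X}·eps L k)²`
  (`= m²(L^jη)²`; module 12's `physMass_pos` ∕ `physMass_le_cap`) for a run of `k ≥ scale X` steps; ONE `(κ, C₅)` for all `k`.
(A LITERAL inhabitant: p418964's §3 carriers `ne5_kingModel_threeFactorDeriv_inhabited` serve verbatim at any profile — `hx`, `hy` ≔
`coarse_val`, `hd` ≔ `le_rfl`, `hEA`, `hEB` ≔ `rfl`; not re-typed here under the 400-line rule.)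
HONEST SCOPE.  (i) `A = 0`, periodic b.c., odd `L ≥ 3`, `m² > 0`, flat blocks; (ii) lattice units of scale `j` (the factor
`(L^jη)^{1−d−γ}` of (2.20) is NOT inserted); (iii) «one lattice mass at all scales» — GONE for the derivative row too; (iv) `j ≥ 1`,
`γ < 1` (the derivative line's alias exponent); (v) Hölder lines (3.74)–(3.75): the same re-run once a `_unif` twin of
`MinimizerTwoSpacingHolder` exists — not here; (vi) not Bałaban's `E^{(j)}(X; g, U)`; not a discharge.  Inputs BY NAME:
`dminimiser_kernel_decay_blocks_unif`, `king_prop38_deriv_torus_blocks_unif` (n15-e), `minimiser_row_decay_unif`,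
`minimiser_row_rate_unif`, `ne5_of_threeFactorRates_lemma45_massProfile`, `physMass_pos`, `physMass_le_cap` (module 12),
`douterRate_le_unif` (p418964), `outerRate_le_unif` (p418046), `aK_le`, `exp_decay_mono`, `blockOf_over`, `tdistT_symm`.

Sources: C. King, Commun. Math. Phys. **102** (1986) 649–677 [King1986] — (2.17) p. 653, (2.20) p. 654, Thm 3.3 (3.6)–(3.8)
pp. 655–656 (derivative clause), Prop. 3.7 (3.64) p. 663, Prop. 3.8 (3.71) p. 664 (second line), Prop. 3.9 (3.73) p. 665, Lemma 4.5
(4.38) p. 674, (4.42)–(4.43) p. 675; T. Bałaban, Commun. Math. Phys. **89** (1983) 571–597 [Balaban1983RegularityDecay] Thm (1.10)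
p. 573 clause 2 («constants … depending on d, M only» — the mass-uniform root); T. Bałaban, Commun. Math. Phys. **109** (1987) 249–301
[Balaban1987RG1] (0.24)–(0.25) p. 257 (the only printed trace of NE5).  No claim about the mass gap.
-/

noncomputable section

namespace Summit.QuantumFields.YangMills.BalabanUVNodes.N18KingModelTorusDerivMassUniform

open Real Matrix
open Literature.MathematicalPhysics.QuantumFieldTheory.Balaban1983to89 (Params)
open Literature.MathematicalPhysics.QuantumFieldTheory.Balaban1983to89.T4OutputRate (Carriers Functional NE5)
open Literature.MathematicalPhysics.QuantumFieldTheory.Balaban1983to89.B5Prop11Plancherel (Tor fine unitVec)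
open Literature.MathematicalPhysics.QuantumFieldTheory.Balaban1983to89.B4Sect5Proof (latticeConst latticeConst_nonneg)
open Literature.MathematicalPhysics.QuantumFieldTheory.King1986
  (aK aK_le lemma43Const prop38RateConst prop38PosConst dprop38RateConst dprop38PosConst exp_decay_mono)
open Literature.MathematicalPhysics.QuantumFieldTheory.King1986.ContinuumLimit (eps)
open Literature.MathematicalPhysics.QuantumFieldTheory.King1986.Torus
  (minimiser effLaplacian blockProj blockOf blockOf_over tdistT tdistT_symm tdistT_nonneg K45 K45_nonneg delta45 delta45_pos
    gam0L gam0L_pos dminimiser_kernel_decay_blocks_unif king_prop38_deriv_torus_blocks_unif)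
open Summit.QuantumFields.YangMills.BalabanUVNodes.N18KingModelTorus (outerRate_le_unif)
open Summit.QuantumFields.YangMills.BalabanUVNodes.N18KingModelTorusDeriv (douterRate_le_unif)
open Summit.QuantumFields.YangMills.BalabanUVNodes.N18KingModelTorusMassUniform
  (minimiser_row_decay_unif minimiser_row_rate_unif ne5_of_threeFactorRates_lemma45_massProfile physMass_pos physMass_le_cap)

variable {d : ℕ}

/-! ## §1 The derivative row at a common rate, mass INSIDE the constants -/

/-- **Mass-uniform twin of `MinimizerTwoSpacingDeriv.dminimiser_row_decay`** (Theorem 3.3's derivative clause ∕ Prop. 3.7 (3.64)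
for `∂^η_μℋ_K` in block-distance currency, weakened to any common rate): for `d ≥ 1`, odd `L > 1`, `a > 0`, a cap `m₀² ≥ 0` there
are `δ₀, c₀ > 0` such that for EVERY `0 ≤ m² ≤ m₀²`, every volume with `K ≥ 1`, every `0 < κ ≤ δ₀`, every fine point `x`, unit
site `b` and direction `μ`: `|N·(ℋ_K(x + e_μ, b) − ℋ_K(x, b))| ≤ a·c₀·e^{−κ·tdistT M (B(x)) b}` (`a_K ≤ a`).  From n15-e's
`dminimiser_kernel_decay_blocks_unif`.
[cite: King1986, Theorem 3.3 (3.7) p.656, Prop. 3.7 (3.64) p.663; Balaban1983RegularityDecay, Theorem (1.10) p.573] -/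
theorem dminimiser_row_decay_unif (dd L : ℕ) (hd : 1 ≤ dd) (hL : Odd L ∧ 1 < L) {a : ℝ} (ha : 0 < a)
    {m0sq : ℝ} (hm0 : 0 ≤ m0sq) :
    ∃ δ₀ c₀ : ℝ, 0 < δ₀ ∧ 0 < c₀ ∧ ∀ (P : Params), P.d = dd → P.L = L → 1 ≤ P.K →
      ∀ (msq : ℝ), 0 ≤ msq → msq ≤ m0sq →
      ∀ (M : Fin P.d → ℕ) [∀ μ, NeZero (M μ)] (_hMK : ∀ μ, M μ = P.sitesPerDir P.K)
        (N : ℕ) [NeZero N] (_hN : N = P.L ^ P.K) (κ : ℝ), 0 < κ → κ ≤ δ₀ →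
        ∀ (xt : Tor (fine N M)) (bt : Tor M) (μ : Fin P.d),
        |(N : ℝ) * (minimiser N M (aK a P.L P.K) (((N : ℕ) : ℝ) ^ 2) msq (Pi.single bt 1) (xt + unitVec (fine N M) μ)
            - minimiser N M (aK a P.L P.K) (((N : ℕ) : ℝ) ^ 2) msq (Pi.single bt 1) xt)|
          ≤ a * c₀ * Real.exp (-(κ * tdistT M (blockOf N M xt) bt)) := by
  obtain ⟨δ₀, c₀, hδ₀, hc₀, H⟩ := dminimiser_kernel_decay_blocks_unif dd L hd hL ha hm0
  refine ⟨δ₀, c₀, hδ₀, hc₀, ?_⟩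
  intro P hPd hPL hK msq hmsq hcap M _ hMK N _ hN κ _ hκδ xt bt μ
  have hLr : (1 : ℝ) < P.L := by exact_mod_cast P.hL.2
  have h1 := H P hPd hPL hK msq hmsq hcap M hMK N hN xt bt μ
  have h2 : aK a P.L P.K * c₀ * Real.exp (-(δ₀ * tdistT M (blockOf N M xt) bt))
      ≤ a * c₀ * Real.exp (-(δ₀ * tdistT M (blockOf N M xt) bt)) :=
    mul_le_mul_of_nonneg_right (mul_le_mul_of_nonneg_right (aK_le ha hLr hK) hc₀.le) (Real.exp_pos _).le
  exact (h1.trans h2).trans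
    (exp_decay_mono (mul_nonneg ha.le hc₀.le) hκδ (tdistT_nonneg M _ _))

/-- **Mass-uniform twin of `MinimizerTwoSpacingDeriv.dminimiser_row_rate`** (Prop. 3.8 (3.71) line 2 in block-distance currency,
weakened to any rate `κ ≤ δ₀∕2`): for `d ≥ 1`, odd `L ≥ 2`, `a > 0`, a cap `m₀² ≥ 0`, `0 ≤ γ < 1` there are `δ₀, c₀ > 0` such that
for EVERY `0 < m² ≤ m₀²`, every volume, every `n ≥ 1`, every `0 < κ ≤ δ₀∕2`, fine points `x` under `x′`, unit site `b` and
direction `μ`: `|∂^{η′}_μℋ_{K+n}(x′, b) − ∂^η_μℋ_K(x, b)| ≤ √((C₁′(K,n) + C₂′)(L^K)^{−γ}·2ac₀)·e^{−κ·tdistT M (B(x)) b}`.  From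
n15-e's `king_prop38_deriv_torus_blocks_unif`. [cite: King1986, Prop. 3.8 (3.71) p.664, p.674] -/
theorem dminimiser_row_rate_unif (dd L : ℕ) (hd : 1 ≤ dd) (hLodd : Odd L) (hL : 2 ≤ L) {a : ℝ} (ha : 0 < a)
    {m0sq : ℝ} (hm0 : 0 ≤ m0sq) {γ : ℝ} (hγ0 : 0 ≤ γ) (hγ1 : γ < 1) :
    ∃ δ₀ c₀ : ℝ, 0 < δ₀ ∧ 0 < c₀ ∧ ∀ (P : Params) (_hPd : P.d = dd) (_hPL : P.L = L) (_hK : 1 ≤ P.K) [NeZero P.L]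
      (m2 : ℝ) (_hm : 0 < m2) (_hcap : m2 ≤ m0sq)
      (n : ℕ) (_hn : 1 ≤ n) (M : Fin P.d → ℕ) [∀ μ, NeZero (M μ)] (_hMK : ∀ μ, M μ = P.sitesPerDir P.K)
      (κ : ℝ) (_hκ : 0 < κ) (_hκδ : κ ≤ δ₀ / 2)
      (xt : Tor (fine (P.L ^ P.K) M)) (xt' : Tor (fine (P.L ^ n * P.L ^ P.K) M)) (bt : Tor M)
      (_hxx : ∀ μ, (xt μ).val = (xt' μ).val / P.L ^ n) (μ : Fin P.d),
      |((P.L ^ n * P.L ^ P.K : ℕ) : ℝ)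
          * (minimiser (P.L ^ n * P.L ^ P.K) M (aK a P.L (P.K + n)) (((P.L ^ n * P.L ^ P.K : ℕ) : ℝ) ^ 2) m2
              (Pi.single bt 1) (xt' + unitVec (fine (P.L ^ n * P.L ^ P.K) M) μ)
            - minimiser (P.L ^ n * P.L ^ P.K) M (aK a P.L (P.K + n)) (((P.L ^ n * P.L ^ P.K : ℕ) : ℝ) ^ 2) m2
              (Pi.single bt 1) xt')
        - ((P.L ^ P.K : ℕ) : ℝ)
          * (minimiser (P.L ^ P.K) M (aK a P.L P.K) (((P.L ^ P.K : ℕ) : ℝ) ^ 2) m2 (Pi.single bt 1)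
              (xt + unitVec (fine (P.L ^ P.K) M) μ)
            - minimiser (P.L ^ P.K) M (aK a P.L P.K) (((P.L ^ P.K : ℕ) : ℝ) ^ 2) m2 (Pi.single bt 1) xt)|
        ≤ Real.sqrt (((dprop38RateConst a a (lemma43Const a P.L P.K n) ((π ^ 2 / 4) ^ P.d) P.d γ
                + dprop38PosConst a ((π ^ 2 / 4) ^ P.d) P.d γ) * ((P.L ^ P.K : ℕ) : ℝ) ^ (-γ)) * (2 * (a * c₀)))
            * Real.exp (-(κ * tdistT M (blockOf (P.L ^ P.K) M xt) bt)) := by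
  obtain ⟨δ₀, c₀, hδ₀, hc₀, H⟩ := king_prop38_deriv_torus_blocks_unif dd L hd hLodd hL ha hm0 hγ0 hγ1
  refine ⟨δ₀, c₀, hδ₀, hc₀, ?_⟩
  intro P hPd hPL hK _ m2 hm hcap n hn M _ hMK κ _ hκδ xt xt' bt hxx μ
  exact (H P hPd hPL hK m2 hm hcap n hn M hMK xt xt' bt hxx μ).trans
    (exp_decay_mono (Real.sqrt_nonneg _) hκδ (tdistT_nonneg M _ _))

/-! ## §2 (3.73), second bound, `j ≥ 1`, on Bałaban's tori — `κ, C₅` from `(d, L, a, m₀², γ)`, every domain its own mass -/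

/-- **KING'S (3.73), SECOND BOUND (`∂_μ` ON THE LEFT EXTERNAL LINE), `j ≥ 1`, MASS-UNIFORM — p418964 with the mass quantified
INSIDE.**  For `d ≥ 1`, odd `L > 1`, `a > 0`, a cap `m₀² > 0`, `0 ≤ γ < 1` there are `κ > 0`, `C₅ ≥ 0` — functions of
`d, L, a, m₀², γ` ONLY — such that: for every `n ≥ 1`; every scale-indexed family of unit tori `L·M_j(μ) = 2L^{m_j}`; every
carriers `C` with `1 ≤ scale X` whose domain `X` of scale `j` reads a direction `μ(X)`, fine points `x_A(X)`, `y_A(X)` UNDER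
`x_B(X)`, `y_B(X)` with tree length at most `|B(x_A) − B(y_A)|_{T₁}`; EVERY MASS PROFILE `mass : C.Dom → ℝ`, `0 < mass X ≤ m₀²`;
every two functionals reading the (4.42) graphs with the DERIVATIVE row — run A `Σ_{z,w} ∂^η_μℋ_j(x_A, z)·C^{(j)}(z, w)·ℋ_j(y_A, w)`,
`∂^η_μℋ_j(x, z) = L^j·(ℋ_j(x + e_μ, z) − ℋ_j(x, z))`, run B `Σ_{z,w} ∂^{η′}_μℋ_{j+n}(x_B, z)·C^{(j+n)}(z, w)·ℋ_{j+n}(y_B, w)` — with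
King's ACTUAL `A = 0` operators of the tree AT THE MASS `mass X`; every window `W`: `NE5 EA EB W κ (L^{−γ∕2}) C₅` — ONE `θ` for all
scales, ONE `(κ, C₅)` for all masses under the cap.  Composition: `ne5_of_threeFactorRates_lemma45_massProfile` at `γ∕2` with
`hu` ≔ `dminimiser_row_decay_unif`, `hv` ≔ `minimiser_row_decay_unif` (∘ `blockOf_over`, `tdistT_symm`), `hdu` ≔
`dminimiser_row_rate_unif` ∘ `douterRate_le_unif`, `hdv` ≔ `minimiser_row_rate_unif` ∘ `outerRate_le_unif` (∘ `tdistT_symm`),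
`κ = min(δ₁, δ₂, δ₃∕2, δ₄∕2, δ₄₅)`.  p418964 = the constant profile `mass X = m²`, cap `m²`.  A = 0 MODEL; periodic b.c.
[cite: King1986, (2.20) p.654, Prop. 3.9 (3.73) p.665, (4.42)–(4.43) p.675, Prop. 3.8 (3.71) p.664, Lemma 4.5 (4.38) p.674,
Theorem 3.3 (3.7) p.656; Balaban1983RegularityDecay, Theorem (1.10) p.573] -/
theorem ne5_kingModel_threeFactorDeriv_torus_unif (hd : 1 ≤ d) (L : ℕ) [NeZero L] (hLp : Odd L ∧ 1 < L) {a : ℝ}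
    (ha : 0 < a) {m0sq : ℝ} (hm0 : 0 < m0sq) {γ : ℝ} (hγ0 : 0 ≤ γ) (hγ1 : γ < 1) :
    ∃ κ C₅ : ℝ, 0 < κ ∧ 0 ≤ C₅ ∧
      ∀ (n : ℕ) (_hn : 1 ≤ n) (M : ℕ → Fin d → ℕ) [∀ j μ, NeZero (M j μ)]
        (_hM : ∀ j, ∃ mm : ℕ, ∀ μ, L * M j μ = 2 * L ^ mm)
        (C : Carriers) (_hsc : ∀ X, 1 ≤ C.scale X) (dir : C.Dom → Fin d)
        (xA yA : (X : C.Dom) → Tor (fine (L ^ C.scale X) (fine L (M (C.scale X)))))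
        (xB yB : (X : C.Dom) → Tor (fine (L ^ n * L ^ C.scale X) (fine L (M (C.scale X)))))
        (_hx : ∀ X μ, (xA X μ).val = (xB X μ).val / L ^ n)
        (_hy : ∀ X μ, (yA X μ).val = (yB X μ).val / L ^ n)
        (_hd : ∀ X, C.d X ≤ tdistT (fine L (M (C.scale X)))
            (blockOf (L ^ C.scale X) (fine L (M (C.scale X))) (xA X))
            (blockOf (L ^ C.scale X) (fine L (M (C.scale X))) (yA X)))
        (mass : C.Dom → ℝ) (_hmass : ∀ X, 0 < mass X) (_hcap : ∀ X, mass X ≤ m0sq)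
        (EA : Functional C C.BgA) (EB : Functional C C.BgB)
        (_hEA : ∀ g U X, EA g U X =
          (fun z => ((L ^ C.scale X : ℕ) : ℝ)
              * (minimiser (L ^ C.scale X) (fine L (M (C.scale X))) (aK a L (C.scale X))
                    (((L ^ C.scale X : ℕ) : ℝ) ^ 2) (mass X) (Pi.single z 1)
                    (xA X + unitVec (fine (L ^ C.scale X) (fine L (M (C.scale X)))) (dir X))
                  - minimiser (L ^ C.scale X) (fine L (M (C.scale X))) (aK a L (C.scale X))
                    (((L ^ C.scale X : ℕ) : ℝ) ^ 2) (mass X) (Pi.single z 1) (xA X)))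
            ⬝ᵥ ((effLaplacian (L ^ C.scale X) (fine L (M (C.scale X))) (aK a L (C.scale X))
                    (((L ^ C.scale X : ℕ) : ℝ) ^ 2) (mass X)
                  + (a * ((L : ℝ) ^ 2)⁻¹) • blockProj L (M (C.scale X)))⁻¹
                *ᵥ fun w => minimiser (L ^ C.scale X) (fine L (M (C.scale X))) (aK a L (C.scale X))
                    (((L ^ C.scale X : ℕ) : ℝ) ^ 2) (mass X) (Pi.single w 1) (yA X)))
        (_hEB : ∀ g U X, EB g U X =
          (fun z => ((L ^ n * L ^ C.scale X : ℕ) : ℝ)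
              * (minimiser (L ^ n * L ^ C.scale X) (fine L (M (C.scale X))) (aK a L (C.scale X + n))
                    (((L ^ n * L ^ C.scale X : ℕ) : ℝ) ^ 2) (mass X) (Pi.single z 1)
                    (xB X + unitVec (fine (L ^ n * L ^ C.scale X) (fine L (M (C.scale X)))) (dir X))
                  - minimiser (L ^ n * L ^ C.scale X) (fine L (M (C.scale X))) (aK a L (C.scale X + n))
                    (((L ^ n * L ^ C.scale X : ℕ) : ℝ) ^ 2) (mass X) (Pi.single z 1) (xB X)))
            ⬝ᵥ ((effLaplacian (L ^ n * L ^ C.scale X) (fine L (M (C.scale X))) (aK a L (C.scale X + n))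
                    (((L ^ n * L ^ C.scale X : ℕ) : ℝ) ^ 2) (mass X)
                  + (a * ((L : ℝ) ^ 2)⁻¹) • blockProj L (M (C.scale X)))⁻¹
                *ᵥ fun w => minimiser (L ^ n * L ^ C.scale X) (fine L (M (C.scale X))) (aK a L (C.scale X + n))
                    (((L ^ n * L ^ C.scale X : ℕ) : ℝ) ^ 2) (mass X) (Pi.single w 1) (yB X)))
        (W : Set (ℕ → ℝ)),
        NE5 EA EB W κ ((L : ℝ) ^ (-(γ / 2))) C₅ := by
  have hd0 : 0 < d := hd
  have hL2 : 2 ≤ L := by have := hLp.2; omega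
  have hγ1' : γ ≤ 1 := hγ1.le
  -- the four outer-line packages, MASS INSIDE: derivative row (§1) and column (module 12 §1), BY NAME
  obtain ⟨δ₁, c₁, hδ₁, hc₁, H₁⟩ := dminimiser_row_decay_unif d L hd hLp ha hm0.le
  obtain ⟨δ₂, c₂, hδ₂, hc₂, H₂⟩ := minimiser_row_decay_unif d L hd hLp ha hm0.le
  obtain ⟨δ₃, c₃, hδ₃, hc₃, H₃⟩ := dminimiser_row_rate_unif d L hd hLp.1 hL2 ha hm0.le hγ0 hγ1
  obtain ⟨δ₄, c₄, hδ₄, hc₄, H₄⟩ := minimiser_row_rate_unif d L hd hLp.1 hL2 ha hm0.le hγ0 hγ1'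
  -- one common decay rate for the four outer lines and the middle line
  have hδ45 : 0 < delta45 d a L := delta45_pos (d := d) ha hL2
  set κ : ℝ := min (min (min δ₁ δ₂) (min (δ₃ / 2) (δ₄ / 2))) (delta45 d a L) with hκ_def
  have hκpos : 0 < κ :=
    lt_min (lt_min (lt_min hδ₁ hδ₂) (lt_min (half_pos hδ₃) (half_pos hδ₄))) hδ45
  have hκ₁ : κ ≤ δ₁ := (min_le_left _ _).trans ((min_le_left _ _).trans (min_le_left _ _))
  have hκ₂ : κ ≤ δ₂ := (min_le_left _ _).trans ((min_le_left _ _).trans (min_le_right _ _))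
  have hκ₃ : κ ≤ δ₃ / 2 := (min_le_left _ _).trans ((min_le_right _ _).trans (min_le_left _ _))
  have hκ₄ : κ ≤ δ₄ / 2 := (min_le_left _ _).trans ((min_le_right _ _).trans (min_le_right _ _))
  have hκ45 : κ ≤ delta45 d a L := min_le_right _ _
  -- the uniform letters
  set Cu : ℝ := prop38RateConst a a (a * (2 * ((a * (1 - ((L : ℝ) ^ 2)⁻¹))⁻¹ + π ^ 2 / 48 + 1 / 3)))
      ((π ^ 2 / 4) ^ d) d γ + prop38PosConst a ((π ^ 2 / 4) ^ d) d γ with hCu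
  set Cu' : ℝ := dprop38RateConst a a (a * (2 * ((a * (1 - ((L : ℝ) ^ 2)⁻¹))⁻¹ + π ^ 2 / 48 + 1 / 3)))
      ((π ^ 2 / 4) ^ d) d γ + dprop38PosConst a ((π ^ 2 / 4) ^ d) d γ with hCu'
  set cA : ℝ := Real.sqrt (2 * (a * c₃) * Cu') with hcA
  set cB : ℝ := Real.sqrt (2 * (a * c₄) * Cu) with hcB
  have hcA0 : 0 ≤ cA := Real.sqrt_nonneg _
  have hcB0 : 0 ≤ cB := Real.sqrt_nonneg _
  have hsA : 0 ≤ a * c₁ := by positivity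
  have hsB : 0 ≤ a * c₂ := by positivity
  have hγ₀ : 0 < gam0L d a L := gam0L_pos ha hL2
  have hK45 : 0 ≤ K45 d a L := K45_nonneg a L
  have hKd : 0 ≤ latticeConst d (κ / 2) := latticeConst_nonneg d (half_pos hκpos).le
  refine ⟨κ / 2, (cA * (2 / gam0L d a L) * (a * c₂) + a * c₁ * K45 d a L * (a * c₂)
      + a * c₁ * (2 / gam0L d a L) * cB) * (latticeConst d (κ / 2)) ^ 2, half_pos hκpos, by positivity, ?_⟩
  intro n hn M _ hM C hsc dir xA yA xB yB hx hy hdd mass hmass hcap EA EB hEA hEB W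
  have hγ2 : γ / 2 ≤ 1 := by linarith
  -- every scale-`j` torus of the family is the unit torus of the Bałaban volume `(d, L, m_j, K)` for any `K`
  have hvol : ∀ (j K : ℕ), ∃ mm : ℕ, ∀ μ, fine L (M j) μ = (⟨d, L, mm, K, hd, hLp⟩ : Params).sitesPerDir K := fun j K => by
    obtain ⟨mm, hmm⟩ := hM j
    exact ⟨mm, fun μ => by simp only [Params.sitesPerDir, Nat.add_sub_cancel]; exact hmm μ⟩
  refine ne5_of_threeFactorRates_lemma45_massProfile (C := C) (EA := EA) (EB := EB) (W := W) L hL2 ha mass hmass hn M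
    hγ2 hsc
    (fun X => blockOf (L ^ C.scale X) (fine L (M (C.scale X))) (xA X))
    (fun X => blockOf (L ^ C.scale X) (fine L (M (C.scale X))) (yA X))
    (fun X z => ((L ^ C.scale X : ℕ) : ℝ)
      * (minimiser (L ^ C.scale X) (fine L (M (C.scale X))) (aK a L (C.scale X))
            (((L ^ C.scale X : ℕ) : ℝ) ^ 2) (mass X) (Pi.single z 1)
            (xA X + unitVec (fine (L ^ C.scale X) (fine L (M (C.scale X)))) (dir X))
          - minimiser (L ^ C.scale X) (fine L (M (C.scale X))) (aK a L (C.scale X))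
            (((L ^ C.scale X : ℕ) : ℝ) ^ 2) (mass X) (Pi.single z 1) (xA X)))
    (fun X z => ((L ^ n * L ^ C.scale X : ℕ) : ℝ)
      * (minimiser (L ^ n * L ^ C.scale X) (fine L (M (C.scale X))) (aK a L (C.scale X + n))
            (((L ^ n * L ^ C.scale X : ℕ) : ℝ) ^ 2) (mass X) (Pi.single z 1)
            (xB X + unitVec (fine (L ^ n * L ^ C.scale X) (fine L (M (C.scale X)))) (dir X))
          - minimiser (L ^ n * L ^ C.scale X) (fine L (M (C.scale X))) (aK a L (C.scale X + n))
            (((L ^ n * L ^ C.scale X : ℕ) : ℝ) ^ 2) (mass X) (Pi.single z 1) (xB X)))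
    (fun X w => minimiser (L ^ C.scale X) (fine L (M (C.scale X))) (aK a L (C.scale X))
      (((L ^ C.scale X : ℕ) : ℝ) ^ 2) (mass X) (Pi.single w 1) (yA X))
    (fun X w => minimiser (L ^ n * L ^ C.scale X) (fine L (M (C.scale X))) (aK a L (C.scale X + n))
      (((L ^ n * L ^ C.scale X : ℕ) : ℝ) ^ 2) (mass X) (Pi.single w 1) (yB X))
    (fun X => (effLaplacian (L ^ C.scale X) (fine L (M (C.scale X))) (aK a L (C.scale X))
        (((L ^ C.scale X : ℕ) : ℝ) ^ 2) (mass X) + (a * ((L : ℝ) ^ 2)⁻¹) • blockProj L (M (C.scale X)))⁻¹)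
    (fun X => (effLaplacian (L ^ n * L ^ C.scale X) (fine L (M (C.scale X))) (aK a L (C.scale X + n))
        (((L ^ n * L ^ C.scale X : ℕ) : ℝ) ^ 2) (mass X) + (a * ((L : ℝ) ^ 2)⁻¹) • blockProj L (M (C.scale X)))⁻¹)
    (fun _ => rfl) (fun _ => rfl) hκpos hκ45 hsA hsB hcA0 hcB0 ?_ ?_ ?_ ?_ hdd hEA hEB
  · -- `hu`: run A's DERIVATIVE row at the mass `mass X` (`dminimiser_row_decay_unif`, volume `(d, L, m_j, j)`)
    intro X z
    obtain ⟨mm, hMK⟩ := hvol (C.scale X) (C.scale X)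
    exact H₁ ⟨d, L, mm, C.scale X, hd, hLp⟩ rfl rfl (hsc X) (mass X) (hmass X).le (hcap X)
      (fine L (M (C.scale X))) hMK (L ^ C.scale X) rfl κ hκpos hκ₁ (xA X) z (dir X)
  · -- `hv`: run B's column at the mass `mass X` (volume `(d, L, m_j, j + n)`), block under `y_B` = `B(y_A)`, `tdistT` symmetric
    intro X w
    obtain ⟨mm, hMK⟩ := hvol (C.scale X) (C.scale X + n)
    have hN : L ^ n * L ^ C.scale X = L ^ (C.scale X + n) := by rw [pow_add, mul_comm]
    have h := H₂ ⟨d, L, mm, C.scale X + n, hd, hLp⟩ rfl rfl (show 1 ≤ C.scale X + n by have := hsc X; omega)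
      (mass X) (hmass X).le (hcap X) (fine L (M (C.scale X))) hMK (L ^ n * L ^ C.scale X) hN κ hκpos hκ₂ (yB X) w
    rw [blockOf_over (fine L (M (C.scale X))) (yA X) (yB X) (hy X), tdistT_symm] at h
    exact h
  · -- `hdu`: the DERIVATIVE row difference at the mass `mass X` ((3.71) line 2, `dminimiser_row_rate_unif`) + `douterRate_le_unif`
    intro X z
    obtain ⟨mm, hMK⟩ := hvol (C.scale X) (C.scale X)
    haveI : NeZero (⟨d, L, mm, C.scale X, hd, hLp⟩ : Params).L := ‹NeZero L›
    have h := H₃ ⟨d, L, mm, C.scale X, hd, hLp⟩ rfl rfl (hsc X) (mass X) (hmass X) (hcap X) n hn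
      (fine L (M (C.scale X))) hMK κ hκpos hκ₃ (xA X) (xB X) z (hx X) (dir X)
    exact h.trans (mul_le_mul_of_nonneg_right (douterRate_le_unif hd0 ha hL2 (hsc X) hn hγ1 hc₃.le)
      (Real.exp_pos _).le)
  · -- `hdv`: the column difference at the mass `mass X` ((3.71) line 1, `minimiser_row_rate_unif`), by symmetry of `tdistT`
    intro X w
    obtain ⟨mm, hMK⟩ := hvol (C.scale X) (C.scale X)
    haveI : NeZero (⟨d, L, mm, C.scale X, hd, hLp⟩ : Params).L := ‹NeZero L›
    have h := H₄ ⟨d, L, mm, C.scale X, hd, hLp⟩ rfl rfl (hsc X) (mass X) (hmass X) (hcap X) n hn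
      (fine L (M (C.scale X))) hMK κ hκpos hκ₄ (yA X) (yB X) w (hy X)
    rw [tdistT_symm (fine L (M (C.scale X))) w]
    exact h.trans (mul_le_mul_of_nonneg_right (outerRate_le_unif hd0 ha hL2 (hsc X) hn hγ1' hc₄.le)
      (Real.exp_pos _).le)

/-! ## §3 King's PHYSICAL profile `m²(L^jη)²` of (2.20): one `(κ, C₅)` for all the slices of a run, derivative row -/

/-- **KING'S (3.73), SECOND BOUND, `j ≥ 1`, AT THE PHYSICAL MASSES OF (2.20).**  For `d ≥ 1`, odd `L > 1`, `a > 0`, a physical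
mass `m² > 0`, `0 ≤ γ < 1` there are `κ > 0`, `C₅ ≥ 0` (functions of `d, L, a, m², γ`) such that for EVERY run length `k`, every
`n ≥ 1`, volumes, carriers with `1 ≤ scale X ≤ k`, directions ∕ fine points ∕ tree lengths as in §2, and functionals reading the
(4.42) DERIVATIVE three-factor graphs of run A (slice `j = scale X` of `G^η_k`, `η = L^{−k} = eps L k`) and run B (slice `j + n` of
`G^{η′}_{k+n}`) AT THE PHYSICAL LATTICE MASS `m²·(L^j·η)²` (the same number for both runs, `L^jη = L^{j+n}η′`):
`NE5 EA EB W κ (L^{−γ∕2}) C₅`.  §2 at the profile `mass X = m²·(L^{scale X}·eps L k)²` (`physMass_pos`, `physMass_le_cap`) — the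
reading in which the slices of (2.17) carry their (2.20) masses; the derivative-row twin of module 12 §4.  A = 0 MODEL; lattice
units of scale `j`. [cite: King1986, (2.17) p.653, (2.20) p.654, Prop. 3.9 (3.73) p.665, (4.42)–(4.43) p.675] -/
theorem ne5_kingModel_threeFactorDeriv_torus_physMass (hd : 1 ≤ d) (L : ℕ) [NeZero L] (hLp : Odd L ∧ 1 < L) {a m2 : ℝ}
    (ha : 0 < a) (hm : 0 < m2) {γ : ℝ} (hγ0 : 0 ≤ γ) (hγ1 : γ < 1) :
    ∃ κ C₅ : ℝ, 0 < κ ∧ 0 ≤ C₅ ∧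
      ∀ (k n : ℕ) (_hn : 1 ≤ n) (M : ℕ → Fin d → ℕ) [∀ j μ, NeZero (M j μ)]
        (_hM : ∀ j, ∃ mm : ℕ, ∀ μ, L * M j μ = 2 * L ^ mm)
        (C : Carriers) (_hsc : ∀ X, 1 ≤ C.scale X) (_hsk : ∀ X, C.scale X ≤ k) (dir : C.Dom → Fin d)
        (xA yA : (X : C.Dom) → Tor (fine (L ^ C.scale X) (fine L (M (C.scale X)))))
        (xB yB : (X : C.Dom) → Tor (fine (L ^ n * L ^ C.scale X) (fine L (M (C.scale X)))))
        (_hx : ∀ X μ, (xA X μ).val = (xB X μ).val / L ^ n)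
        (_hy : ∀ X μ, (yA X μ).val = (yB X μ).val / L ^ n)
        (_hd : ∀ X, C.d X ≤ tdistT (fine L (M (C.scale X)))
            (blockOf (L ^ C.scale X) (fine L (M (C.scale X))) (xA X))
            (blockOf (L ^ C.scale X) (fine L (M (C.scale X))) (yA X)))
        (EA : Functional C C.BgA) (EB : Functional C C.BgB)
        (_hEA : ∀ g U X, EA g U X =
          (fun z => ((L ^ C.scale X : ℕ) : ℝ)
              * (minimiser (L ^ C.scale X) (fine L (M (C.scale X))) (aK a L (C.scale X))
                    (((L ^ C.scale X : ℕ) : ℝ) ^ 2) (m2 * ((L : ℝ) ^ C.scale X * eps L k) ^ 2) (Pi.single z 1)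
                    (xA X + unitVec (fine (L ^ C.scale X) (fine L (M (C.scale X)))) (dir X))
                  - minimiser (L ^ C.scale X) (fine L (M (C.scale X))) (aK a L (C.scale X))
                    (((L ^ C.scale X : ℕ) : ℝ) ^ 2) (m2 * ((L : ℝ) ^ C.scale X * eps L k) ^ 2) (Pi.single z 1) (xA X)))
            ⬝ᵥ ((effLaplacian (L ^ C.scale X) (fine L (M (C.scale X))) (aK a L (C.scale X))
                    (((L ^ C.scale X : ℕ) : ℝ) ^ 2) (m2 * ((L : ℝ) ^ C.scale X * eps L k) ^ 2)
                  + (a * ((L : ℝ) ^ 2)⁻¹) • blockProj L (M (C.scale X)))⁻¹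
                *ᵥ fun w => minimiser (L ^ C.scale X) (fine L (M (C.scale X))) (aK a L (C.scale X))
                    (((L ^ C.scale X : ℕ) : ℝ) ^ 2) (m2 * ((L : ℝ) ^ C.scale X * eps L k) ^ 2) (Pi.single w 1) (yA X)))
        (_hEB : ∀ g U X, EB g U X =
          (fun z => ((L ^ n * L ^ C.scale X : ℕ) : ℝ)
              * (minimiser (L ^ n * L ^ C.scale X) (fine L (M (C.scale X))) (aK a L (C.scale X + n))
                    (((L ^ n * L ^ C.scale X : ℕ) : ℝ) ^ 2) (m2 * ((L : ℝ) ^ C.scale X * eps L k) ^ 2) (Pi.single z 1)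
                    (xB X + unitVec (fine (L ^ n * L ^ C.scale X) (fine L (M (C.scale X)))) (dir X))
                  - minimiser (L ^ n * L ^ C.scale X) (fine L (M (C.scale X))) (aK a L (C.scale X + n))
                    (((L ^ n * L ^ C.scale X : ℕ) : ℝ) ^ 2) (m2 * ((L : ℝ) ^ C.scale X * eps L k) ^ 2) (Pi.single z 1)
                    (xB X)))
            ⬝ᵥ ((effLaplacian (L ^ n * L ^ C.scale X) (fine L (M (C.scale X))) (aK a L (C.scale X + n))
                    (((L ^ n * L ^ C.scale X : ℕ) : ℝ) ^ 2) (m2 * ((L : ℝ) ^ C.scale X * eps L k) ^ 2)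
                  + (a * ((L : ℝ) ^ 2)⁻¹) • blockProj L (M (C.scale X)))⁻¹
                *ᵥ fun w => minimiser (L ^ n * L ^ C.scale X) (fine L (M (C.scale X))) (aK a L (C.scale X + n))
                    (((L ^ n * L ^ C.scale X : ℕ) : ℝ) ^ 2) (m2 * ((L : ℝ) ^ C.scale X * eps L k) ^ 2)
                    (Pi.single w 1) (yB X)))
        (W : Set (ℕ → ℝ)),
        NE5 EA EB W κ ((L : ℝ) ^ (-(γ / 2))) C₅ := by
  have hL1 : 1 ≤ L := by have := hLp.2; omega
  obtain ⟨κ, C₅, hκ, hC₅, H⟩ := ne5_kingModel_threeFactorDeriv_torus_unif hd L hLp ha hm hγ0 hγ1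
  exact ⟨κ, C₅, hκ, hC₅, fun k n hn M _ hM C hsc hsk dir xA yA xB yB hx hy hdd EA EB hEA hEB W =>
    H n hn M hM C hsc dir xA yA xB yB hx hy hdd (fun X => m2 * ((L : ℝ) ^ C.scale X * eps L k) ^ 2)
      (fun X => physMass_pos hL1 hm _ _) (fun X => physMass_le_cap hL1 hm.le (hsk X)) EA EB hEA hEB W⟩

end Summit.QuantumFields.YangMills.BalabanUVNodes.N18KingModelTorusDerivMassUniform

end
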